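import Summits.ABC.ABC.Theses.DefiniteXi
import Literature.NumberTheory.EllipticCurves.DegreeConjectureAbcMurtyProofs
import Literature.NumberTheory.DiophantineGeometry.MinimalDiscriminantFactorizationProofs

/-!
# Load-bearing analysis of crux `DefiniteXi.FreyDegreeBound`: level and non-degeneracy hypotheses
# (negative-side support, cdisprove of stmt-ABC-2019)

* `cuspForm_gamma0_one_eq_zero`, `not_isNormalized_zero`, `isEmpty_modularParametrizationData_one` —
  `S₂(Γ₀(1)) = 0` (Mathlib's level-one dimension formula, transported along `Γ₀(1) = Γ(1) ↦ 𝒮ℒ`),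
  so there is NO modular parametrisation datum of any Weierstrass curve at level `1`.
* `freyDegreeBound_false_without_conductor` — the hypothesis `conductorNorm ℤ (freyCurve a b) = N`
  of the crux is load-bearing: asked at every level `N ≥ 1` the statement fails at `N = 1`.
* `conductorNorm_of_Δ_eq_zero`, `freyDegreeBound_false_without_nonzero` — the hypothesis
  `ab(a+b) ≠ 0` is load-bearing: a singular Weierstrass curve has the junk conductor `1`
  (every `ord_v(Δ_min) = 0`), so `E_{0,1}` would need a datum at level `1`.
* `conductorNorm_freyCurve_unbounded` — conductors of Frey curves are unbounded (`a = 1`, `b = p`).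
-/

noncomputable section

open scoped MatrixGroups
open IsDedekindDomain
open Literature.NumberTheory.EllipticCurves Literature.NumberTheory.EllipticCurves.ModularForms
  UniqueFactorizationMonoid

namespace Summit.ABC.ABC.Theorems.FreyDegreeBound.Negative

/-- `Γ₀(1) = SL₂(ℤ)`: the weight-`2` cusp forms on `Γ₀(1)` vanish (Mathlib:
`CuspForm.rank_eq_zero_of_weight_lt_twelve` for `𝒮ℒ`, transported along
`↑(Γ₀(1)) = ↑(Γ(1)) = 𝒮ℒ`). -/
theorem cuspForm_gamma0_one_eq_zero (f : CuspForm (CongruenceSubgroup.Gamma0 1) 2) : f = 0 := by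
  have hΓ : ((CongruenceSubgroup.Gamma0 1 : Subgroup (Matrix.SpecialLinearGroup (Fin 2) ℤ)) :
      Subgroup (GL (Fin 2) ℝ)) = 𝒮ℒ := by
    have : CongruenceSubgroup.Gamma0 1 = CongruenceSubgroup.Gamma 1 := by
      rw [CongruenceSubgroup.Gamma_one_top]; ext A; simp [eq_iff_true_of_subsingleton]
    rw [this]; exact CongruenceSubgroup.Gamma_one_coe_eq_SL
  suffices h : ∀ Γ : Subgroup (GL (Fin 2) ℝ), Γ = 𝒮ℒ → ∀ g : CuspForm Γ 2, g = 0 from h _ hΓ f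
  rintro Γ rfl g
  exact rank_zero_iff_forall_zero.mp (CuspForm.rank_eq_zero_of_weight_lt_twelve (by norm_num)) g

/-- The zero cusp form is not normalised (`a₁(0) = 0 ≠ 1`). -/
theorem not_isNormalized_zero {Γ : Subgroup (GL (Fin 2) ℝ)} {k : ℤ} :
    ¬ IsNormalized (0 : CuspForm Γ k) := by
  unfold IsNormalized
  have : ((0 : CuspForm Γ k) : UpperHalfPlane → ℂ) = 0 := rfl
  rw [this, UpperHalfPlane.qExpansion_zero]
  simp

/-- **No modular parametrisation datum at level `1`** (for any Weierstrass curve over `ℚ`): its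
newform would be a normalised element of `S₂(Γ₀(1)) = 0`. -/
theorem isEmpty_modularParametrizationData_one (W : WeierstrassCurve ℚ) :
    IsEmpty (ModularParametrizationData W 1) := by
  refine ⟨fun D ↦ ?_⟩
  have hf : D.f = 0 := cuspForm_gamma0_one_eq_zero D.f
  have hn := D.isNewformOf.1.2.2
  rw [hf] at hn
  exact not_isNormalized_zero hn

/-- **Load-bearing hypothesis `conductorNorm = N`.** The crux with the level freed from the
conductor — "at EVERY level `N ≥ 1` some datum of degree `≤ C N^{2+ε}`" — is false: at level `1`
there is no datum at all (take `ε = 1`, `a = b = 1`). Any proof of the crux must use that the level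
is the conductor (where modularity supplies data). -/
theorem freyDegreeBound_false_without_conductor :
    ¬ ∀ ε : ℝ, 0 < ε → ∃ C : ℝ, ∀ a b : ℤ, IsCoprime a b → a * b * (a + b) ≠ 0 →
      ∀ (N : ℕ) [NeZero N], ∃ D : ModularParametrizationData (freyCurve a b) N,
        (D.deg : ℝ) ≤ C * (N : ℝ) ^ (2 + ε) := by
  intro h
  obtain ⟨C, hC⟩ := h 1 one_pos
  obtain ⟨D, -⟩ := hC 1 1 isCoprime_one_left (by norm_num) 1
  exact (isEmpty_modularParametrizationData_one (freyCurve 1 1)).false D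

/-- Junk value of the conductor of a SINGULAR Weierstrass curve: `Δ = 0` makes every
`ord_v(Δ_min) = 0` (`addVal 0 = ⊤`, `⊤.toNat = 0`), so every `f_v = 0 + 1 − m_v = 0` and
`N = #(ℤ/1) = 1`. -/
theorem conductorNorm_of_Δ_eq_zero (W : WeierstrassCurve ℚ) (hW : W.Δ = 0) :
    W.conductorNorm ℤ = 1 := by
  have hord : ∀ v : HeightOneSpectrum ℤ, W.ordMinimalDiscriminant v = 0 := by
    intro v
    change (IsDiscreteValuationRing.addVal _ ((((W.baseChange (v.adicCompletion ℚ)).minimal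
      (v.adicCompletionIntegers ℚ)).integralModel (v.adicCompletionIntegers ℚ)).Δ)).toNat = 0
    have h0 : (((W.baseChange (v.adicCompletion ℚ)).minimal (v.adicCompletionIntegers ℚ)).integralModel
        (v.adicCompletionIntegers ℚ)).Δ = 0 := by
      apply FaithfulSMul.algebraMap_injective (v.adicCompletionIntegers ℚ) (v.adicCompletion ℚ)
      rw [WeierstrassCurve.integralModel_Δ_eq, map_zero, WeierstrassCurve.minimal,
        WeierstrassCurve.variableChange_Δ, WeierstrassCurve.baseChange, WeierstrassCurve.map_Δ, hW,
        map_zero, mul_zero]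
    rw [h0, IsDiscreteValuationRing.addVal_zero, ENat.toNat_top]
  have hf : ∀ v : HeightOneSpectrum ℤ, W.conductorExponent v = 0 := by
    intro v
    have := (W.kodairaSymbolAt v).numComponents_pos
    unfold WeierstrassCurve.conductorExponent WeierstrassCurve.numComponentsAt
    rw [hord v]; omega
  unfold WeierstrassCurve.conductorNorm WeierstrassCurve.conductor
  simp only [hf, pow_zero]
  rw [finprod_one]
  simp

/-- **Load-bearing hypothesis `ab(a+b) ≠ 0`.** Without it the crux is (junk-)false: `E_{0,1}`
(`y² = x²(x + 1)`, `Δ = 0`) has `conductorNorm = 1` and there is no parametrisation datum at level 1. -/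
theorem freyDegreeBound_false_without_nonzero :
    ¬ ∀ ε : ℝ, 0 < ε → ∃ C : ℝ, ∀ a b : ℤ, IsCoprime a b →
      ∀ (N : ℕ) [NeZero N], (freyCurve a b).conductorNorm ℤ = N →
        ∃ D : ModularParametrizationData (freyCurve a b) N,
          (D.deg : ℝ) ≤ C * (N : ℝ) ^ (2 + ε) := by
  intro h
  obtain ⟨C, hC⟩ := h 1 one_pos
  have hΔ : (freyCurve 0 1).Δ = 0 := by rw [freyCurve_Δ]; simp
  obtain ⟨D, -⟩ := hC 0 1 isCoprime_one_right 1 (conductorNorm_of_Δ_eq_zero _ hΔ)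
  exact (isEmpty_modularParametrizationData_one (freyCurve 0 1)).false D


/-- Conductors of Frey curves are unbounded: `rad(p(p+1)) ∣ 2 N_{E_{1,p}}` gives `p ≤ 2 N_{E_{1,p}}`
for every prime `p`. -/
theorem conductorNorm_freyCurve_unbounded (M : ℕ) :
    ∃ a b : ℤ, IsCoprime a b ∧ a * b * (a + b) ≠ 0 ∧ M < (freyCurve a b).conductorNorm ℤ := by
  obtain ⟨p, hpM, hp⟩ := Nat.exists_infinite_primes (2 * M + 1)
  have hp0 : (p : ℤ) ≠ 0 := by exact_mod_cast hp.ne_zero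
  have h0 : (1 : ℤ) * p * (1 + p) ≠ 0 := by positivity
  refine ⟨1, p, isCoprime_one_left, h0, ?_⟩
  have hdvd := radical_natAbs_dvd_two_mul_conductorNorm_freyCurve (isCoprime_one_left (x := (p : ℤ))) h0
  have hm0 : ((1 : ℤ) * p * (1 + p)).natAbs ≠ 0 := Int.natAbs_ne_zero.mpr h0
  have hnat : ((1 : ℤ) * p * (1 + p)).natAbs = p * (1 + p) := by
    have : (1 : ℤ) * p * (1 + p) = ((p * (1 + p) : ℕ) : ℤ) := by push_cast; ring
    rw [this, Int.natAbs_natCast]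
  have hpm : p ∣ ((1 : ℤ) * p * (1 + p)).natAbs := hnat ▸ dvd_mul_right p (1 + p)
  have hpr : p ∣ radical ((1 : ℤ) * p * (1 + p)).natAbs :=
    Nat.dvd_of_mem_primeFactors (by rw [Nat.primeFactors_radical]; exact Nat.mem_primeFactors.mpr ⟨hp, hpm, hm0⟩)
  haveI := isElliptic_freyCurve h0
  have hNpos : 0 < (freyCurve (1 : ℤ) p).conductorNorm ℤ := WeierstrassCurve.conductorNorm_pos_holds _
  have hle : p ≤ 2 * (freyCurve (1 : ℤ) p).conductorNorm ℤ :=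
    Nat.le_of_dvd (by positivity) (dvd_trans hpr hdvd)
  omega

end Summit.ABC.ABC.Theorems.FreyDegreeBound.Negative

end
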